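import Summits.CriticalPhenomena.PercolationContinuityZ3.Theorems.PercNearOneGluingNoHeavyQuantFarTreeChainLevels
import Summits.CriticalPhenomena.PercolationContinuityZ3.Theorems.PercNearOneGluingNoHeavyQuantFarTreeChainStep
import Summits.CriticalPhenomena.PercolationContinuityZ3.Theorems.PercNearOneGluingNoHeavyQuantSecondWeightLevels
import HarnessLib

/-!
# QUANT lane R8 — THE MULTI-COMPANION INEQUALITY on every rooted tree (gate coordinates): layer one of FAR on trees

builds on p205010 (kernel theorem, internal audit signed; external expert review pending)

Support file (`--supports stmt-CriticalPhenomena-4575`), QUANT lane lead (gen 8), rung R8 of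
`run/shared/lean/prim/quant/LADDER.md`; memo `prim-quant-lead-g7/LEAD-NOTES-G7.md` N16/N17 (paper proof, lead g7; this is its
formalisation).  Trees in `par`/`depth` coordinates (root `o`, `anc x = {par^[i] x | i ≤ depth x}` for `x ≠ o`), independent vertex gates
`prodBernoulli q` on `Set ι`, a vertex `y ≠ o` REACHED iff its chain is open (`↑(anc y) ⊆ ω`), `T y = ∏_{anc y} q` its marginal.
Theorems only; no sorries; standard axioms.

* `Quant.tree_twoReached_ge` — **multi-companion inequality (tree-MC).**  `a ≠ o`, `B` a finite set of other non-root vertices with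
  `T b ≥ T a` for every `b ∈ B` and `Σ_{b∈B} T b ≥ 1`.  Then `P(at least two of {a} ∪ B are reached) ≥ T a`.
  (Two companions with `T b + T c ≥ 1`: `Quant.prodBernoulli_twoOfThree_ge`, p221656; the general case is this file.)
  PROOF.  Trivial if some `b ∈ B` is an ancestor or a descendant of `a`.  Otherwise every `b` hangs off the chain
  `v 0, …, v D = a` of `a` at LEVEL `k = |anc a ∩ anc b| ≤ D` (`…QuantFarTreeChainLevels.lean`): `anc b = Ch k ⊔ inner b`.  With `B_k` the
  companions of level `k`, `C_k = #{b ∈ B_k : inner b open}` (independent over `k`, and of the chain gates), the events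
  `G_k^{(i)} = {≥ i of {a} ∪ B_{≥k} reached}` satisfy, by `Quant.chain_step_real` (`…QuantFarTreeChainStep.lean`),
  `P(G_k^{(2)}) = π_k t_k + s_k P(G_{k+1}^{(1)}) + z_k P(G_{k+1}^{(2)})`, `P(G_k^{(1)}) = π_k (1 − z_k) + z_k P(G_{k+1}^{(1)})`
  (`π_k = ∏_{Ch k} q`, `(z_k, s_k, t_k) = P(C_k = 0, = 1, ≥ 2)`), i.e. `(P G_0^{(2)}, P G_0^{(1)}) = EFG[levels, T a]` — the recursion of
  `…QuantSecondWeightLevels.lean`; the levels are admissible (`count_trichotomy_real`, `count_moment_bounds`, `n_k T a ≤ π_k m_k` from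
  `T b ≥ T a`) with non-increasing weights, so the CHAIN LEMMA `Quant.SecondWeight.secondWeight_levels` gives
  `P(G_0^{(2)}) ≥ T a · min(1, Σ_k π_k m_k) = T a · min(1, Σ_B T b) = T a`.
* `Quant.tree_card_le_one_le_of_sum` — counting form: for a finite set `R` of non-root vertices containing `a` with `T a` minimal on `R` and
  `Σ_{R ∖ a} T ≥ 1`: `P(#{y ∈ R reached} ≤ 1) ≤ 1 − T a`.  With `Σ_R T > 2` this is LAYER ONE (`j = 1`) OF `Quant.FarRelayRow` ON EVERY TREE
  (route vocabulary in `…QuantFarTreeLayerOneAll.lean`).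
[cite: KozmaNitzan2024, Lemma 2 (p. 6), Conjecture 3 (p. 15)] (the gluing rows this serves); [cite: Grimmett1999, §1.3 p. 10; §2.2] (product measure,
events on disjoint coordinate sets); the theorems [this work].  Numerics: lead g7 `explore/mc_test.py` (7 263 adversarial trees, 0 violations).
-/

noncomputable section

namespace Summit.CriticalPhenomena.PercolationContinuityZ3.Theorems

namespace Quant

open Finset MeasureTheory
open Literature.Probability.LatticeModels
open Literature.Probability.Percolation
open scoped Classical

variable {ι : Type*} (o : ι) (depth : ι → ℕ) (par : ι → ι)

/-- the ancestral chain `{par^[i] y | i ≤ depth y}` of `y` (root excluded) -/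
local notation3 "anc⟦" y "⟧" => Finset.image (fun i => par^[i] y) (Finset.range (depth y + 1))
/-- the chain prefix `{par^[depth a − j] a | j < k}` of `a` (its top `k` vertices) -/
local notation3 "Ch⟦" a ", " k "⟧" => Finset.image (fun j => par^[depth a - j] a) (Finset.range k)
/-- `EFG[L, x] = (E W, E F)` for general levels (as in `…QuantSecondWeightLevels.lean`). -/
local notation3 "EFG[" L ", " x "]" =>
  (List.foldr (fun (l : ℝ × ℝ × ℝ × ℝ × ℝ) (acc : ℝ × ℝ) =>
      (l.2.1 * acc.1 + l.2.2.1 * acc.2 + l.2.2.2.1 * l.1, (1 - l.2.1) * l.1 + l.2.1 * acc.2)) ((0 : ℝ), (x : ℝ)) L)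
/-- `σG[L] = Σ w m`. -/
local notation3 "σG[" L "]" => (List.sum (List.map (fun (l : ℝ × ℝ × ℝ × ℝ × ℝ) => l.1 * l.2.2.2.2) L))

/-! ### Two list utilities -/

/-- A list `[f k, f (k+1), …]` of values of a non-increasing sequence is non-increasing. [folklore] -/
theorem pairwise_map_range'_of_succ_le (f : ℕ → ℝ) (hf : ∀ j, f (j + 1) ≤ f j) (k n : ℕ) :
    ((List.range' k n).map f).Pairwise (fun u v => v ≤ u) := by
  have hanti : Antitone f := antitone_nat_of_succ_le hf
  induction n generalizing k with
  | zero => simp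
  | succ n ih =>
    rw [List.range'_succ, List.map_cons, List.pairwise_cons]
    refine ⟨fun v hv => ?_, ih (k + 1)⟩
    obtain ⟨j, hj, rfl⟩ := List.mem_map.1 hv
    have := (List.mem_range'_1.1 hj).1
    exact hanti (by omega)

/-- `Σ_{[k, …, k+n−1]} g = Σ_{j < n} g (k + j)`. [folklore] -/
theorem sum_map_range' (g : ℕ → ℝ) (k n : ℕ) : ((List.range' k n).map g).sum = ∑ j ∈ Finset.range n, g (k + j) := by
  induction n generalizing k with
  | zero => simp
  | succ n ih =>
    rw [List.range'_succ, List.map_cons, List.sum_cons, ih (k + 1), Finset.sum_range_succ', add_zero, add_comm]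
    congr 1
    exact Finset.sum_congr rfl fun j _ => by rw [add_assoc, add_comm 1 j]

/-! ### The multi-companion inequality -/

/-- **THE MULTI-COMPANION INEQUALITY (layer one of FAR on every tree, gate coordinates).**  Rooted tree in `par`/`depth` coordinates,
independent vertex gates `prodBernoulli q`; `a ≠ o` and a finite set `B` of other non-root vertices with `∏_{anc a} q ≤ ∏_{anc b} q` for
all `b ∈ B` and `1 ≤ Σ_{b∈B} ∏_{anc b} q`.  Then `∏_{anc a} q ≤ P(at least two of the chains anc y, y ∈ {a} ∪ B, are open)`. [this work] -/
theorem tree_twoReached_ge (hstep : ∀ x, x ≠ o → depth x ≠ 0 → par x ≠ o ∧ depth (par x) + 1 = depth x)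
    [Finite ι] (q : ι → unitInterval) {a : ι} (hao : a ≠ o) (B : Finset ι) (haB : a ∉ B) (hoB : o ∉ B)
    (hge : ∀ b ∈ B, ∏ i ∈ anc⟦a⟧, (q i : ℝ) ≤ ∏ i ∈ anc⟦b⟧, (q i : ℝ))
    (hsum : 1 ≤ ∑ b ∈ B, ∏ i ∈ anc⟦b⟧, (q i : ℝ)) :
    ∏ i ∈ anc⟦a⟧, (q i : ℝ) ≤
      (prodBernoulli q).real {ω : Set ι | 2 ≤ ((insert a B).filter fun y => ((anc⟦y⟧ : Finset ι) : Set ι) ⊆ ω).card} := by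
  set μ := prodBernoulli q with hμ
  have hmeas : ∀ S : Set (Set ι), MeasurableSet S := fun S => (Set.toFinite S).measurableSet
  set x : ℝ := ∏ i ∈ anc⟦a⟧, (q i : ℝ) with hx
  have hx0 : 0 ≤ x := prod_unit_nonneg q _
  rcases hx0.eq_or_lt with hx0' | hxpos
  · rw [← hx0']; exact measureReal_nonneg
  have hBo : ∀ b ∈ B, b ≠ o := fun b hb h => hoB (h ▸ hb)
  have hPa : μ.real {ω : Set ι | ((anc⟦a⟧ : Finset ι) : Set ι) ⊆ ω} = x := prodBernoulli_real_subset q _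
  -- two distinct open chains give the event
  have htwo : ∀ ω : Set ι, ∀ u v : ι, u ∈ insert a B → v ∈ insert a B → u ≠ v →
      ((anc⟦u⟧ : Finset ι) : Set ι) ⊆ ω → ((anc⟦v⟧ : Finset ι) : Set ι) ⊆ ω →
      ω ∈ {ω : Set ι | 2 ≤ ((insert a B).filter fun y => ((anc⟦y⟧ : Finset ι) : Set ι) ⊆ ω).card} := by
    intro ω u v hu hv huv hou hov
    have h2 : ({u, v} : Finset ι) ⊆ (insert a B).filter fun y => ((anc⟦y⟧ : Finset ι) : Set ι) ⊆ ω := by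
      intro y hy
      rw [Finset.mem_insert, Finset.mem_singleton] at hy
      rw [Finset.mem_filter]
      rcases hy with rfl | rfl
      · exact ⟨hu, hou⟩
      · exact ⟨hv, hov⟩
    have := Finset.card_le_card h2
    rw [Finset.card_pair huv] at this
    exact this
  -- Step 0: trivial cases (a companion is an ancestor or a descendant of `a`)
  by_cases htriv : ∃ b ∈ B, b ∈ anc⟦a⟧ ∨ a ∈ anc⟦b⟧
  · obtain ⟨b, hbB, hb⟩ := htriv
    have hba : b ≠ a := fun h => haB (h ▸ hbB)
    rcases hb with hb | hb
    · have hsub : {ω : Set ι | ((anc⟦a⟧ : Finset ι) : Set ι) ⊆ ω} ⊆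
          {ω : Set ι | 2 ≤ ((insert a B).filter fun y => ((anc⟦y⟧ : Finset ι) : Set ι) ⊆ ω).card} := fun ω hω =>
        htwo ω a b (Finset.mem_insert_self a B) (Finset.mem_insert_of_mem hbB) hba.symm hω
          (subset_trans (Finset.coe_subset.2 (tree_anc_subset o depth par hstep hao hb)) hω)
      rw [← hPa]
      exact measureReal_mono hsub (measure_ne_top _ _)
    · have hsub : {ω : Set ι | ((anc⟦b⟧ : Finset ι) : Set ι) ⊆ ω} ⊆
          {ω : Set ι | 2 ≤ ((insert a B).filter fun y => ((anc⟦y⟧ : Finset ι) : Set ι) ⊆ ω).card} := fun ω hω =>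
        htwo ω a b (Finset.mem_insert_self a B) (Finset.mem_insert_of_mem hbB) hba.symm
          (subset_trans (Finset.coe_subset.2 (tree_anc_subset o depth par hstep (hBo b hbB) hb)) hω) hω
      calc x ≤ ∏ i ∈ anc⟦b⟧, (q i : ℝ) := hge b hbB
        _ = μ.real {ω : Set ι | ((anc⟦b⟧ : Finset ι) : Set ι) ⊆ ω} := (prodBernoulli_real_subset q _).symm
        _ ≤ _ := measureReal_mono hsub (measure_ne_top _ _)
  push Not at htriv
  -- Main case: the level structure along the chain of `a`
  set D := depth a with hD
  set L : ι → ℕ := fun b => (anc⟦a⟧ ∩ anc⟦b⟧).card with hL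
  set inner : ι → Finset ι := fun b => anc⟦b⟧ \ anc⟦a⟧ with hinner
  set π : ℕ → ℝ := fun k => ∏ i ∈ Ch⟦a, k⟧, (q i : ℝ) with hπ
  set Bk : ℕ → Finset ι := fun k => B.filter fun b => L b = k with hBk
  set Bge : ℕ → Finset ι := fun k => B.filter fun b => k ≤ L b with hBge
  set z : ℕ → ℝ := fun k => μ.real {ω : Set ι | ((Bk k).filter fun b => ((inner b : Finset ι) : Set ι) ⊆ ω).card = 0} with hz
  set s : ℕ → ℝ := fun k => μ.real {ω : Set ι | ((Bk k).filter fun b => ((inner b : Finset ι) : Set ι) ⊆ ω).card = 1} with hs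
  set t : ℕ → ℝ := fun k => μ.real {ω : Set ι | 2 ≤ ((Bk k).filter fun b => ((inner b : Finset ι) : Set ι) ⊆ ω).card} with ht
  set m : ℕ → ℝ := fun k => ∑ b ∈ Bk k, ∏ i ∈ inner b, (q i : ℝ) with hm
  set lev : ℕ → ℝ × ℝ × ℝ × ℝ × ℝ := fun k => (π k, z k, s k, t k, m k) with hlev
  -- structural facts
  have hLk : ∀ b ∈ B, anc⟦a⟧ ∩ anc⟦b⟧ = Ch⟦a, L b⟧ ∧ L b ≤ D := fun b hb =>
    anc_inter_eq_chainPrefix o depth par hstep hao (hBo b hb) (htriv b hb).2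
  have hsplit : ∀ b ∈ B, anc⟦b⟧ = Ch⟦a, L b⟧ ∪ inner b := fun b hb =>
    (anc_eq_chainPrefix_union_inner o depth par hstep hao (hBo b hb) (htriv b hb).2).1
  have hChA : ∀ k, Ch⟦a, k⟧ ⊆ anc⟦a⟧ := fun k => chainPrefix_subset_anc depth par a k
  have hKI : ∀ k, ∀ b ∈ B, Disjoint (Ch⟦a, k⟧) (inner b) := fun k b _ =>
    Finset.disjoint_of_subset_left (hChA k) Finset.disjoint_sdiff
  have hChY : ∀ k, ∀ y ∈ B, k ≤ L y → Ch⟦a, k⟧ ⊆ anc⟦y⟧ := by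
    intro k y hy hky
    refine subset_trans (chainPrefix_mono depth par a hky) ?_
    rw [← (hLk y hy).1]
    exact Finset.inter_subset_right
  have hTb : ∀ b ∈ B, ∏ i ∈ anc⟦b⟧, (q i : ℝ) = π (L b) * ∏ i ∈ inner b, (q i : ℝ) := by
    intro b hb
    rw [hsplit b hb, Finset.prod_union (hKI (L b) b hb)]
  have hπanti : ∀ j, π (j + 1) ≤ π j := fun j => prod_unit_anti q (chainPrefix_mono depth par a (Nat.le_succ j))
  have hxπ : ∀ k, x ≤ π k := fun k => prod_unit_anti q (hChA k)
  -- Step 1: the recursion down the chain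
  have hrec : ∀ n k : ℕ, k + n = D + 1 →
      μ.real {ω : Set ι | 2 ≤ ((insert a (Bge k)).filter fun y => ((anc⟦y⟧ : Finset ι) : Set ι) ⊆ ω).card} =
          (EFG[(List.range' k n).map lev, x]).1 ∧
        μ.real {ω : Set ι | 1 ≤ ((insert a (Bge k)).filter fun y => ((anc⟦y⟧ : Finset ι) : Set ι) ⊆ ω).card} =
          (EFG[(List.range' k n).map lev, x]).2 := by
    intro n
    induction n with
    | zero =>
      intro k hk
      have hBgek : Bge k = ∅ := by
        rw [hBge, Finset.filter_eq_empty_iff]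
        intro b hb hkb
        have := (hLk b hb).2
        omega
      simp only [hBgek, List.range'_zero, List.map_nil, List.foldr_nil]
      have hfilt : ∀ ω : Set ι, (({a} : Finset ι).filter fun y => ((anc⟦y⟧ : Finset ι) : Set ι) ⊆ ω) =
          if ((anc⟦a⟧ : Finset ι) : Set ι) ⊆ ω then {a} else ∅ := fun ω => Finset.filter_singleton _ a
      constructor
      · have : {ω : Set ι | 2 ≤ ((insert a (∅ : Finset ι)).filter fun y => ((anc⟦y⟧ : Finset ι) : Set ι) ⊆ ω).card} = ∅ := by
          rw [Set.eq_empty_iff_forall_notMem]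
          intro ω hω
          have h2 : 2 ≤ ((insert a (∅ : Finset ι)).filter fun y => ((anc⟦y⟧ : Finset ι) : Set ι) ⊆ ω).card := hω
          rw [Finset.insert_empty, hfilt ω] at h2
          split_ifs at h2 <;> simp at h2
        rw [this, measureReal_empty]
      · have : {ω : Set ι | 1 ≤ ((insert a (∅ : Finset ι)).filter fun y => ((anc⟦y⟧ : Finset ι) : Set ι) ⊆ ω).card} =
            {ω : Set ι | ((anc⟦a⟧ : Finset ι) : Set ι) ⊆ ω} := by
          ext ω
          simp only [Set.mem_setOf_eq, Finset.insert_empty, hfilt ω]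
          constructor
          · intro h1
            by_contra hna
            rw [if_neg hna, Finset.card_empty] at h1
            exact absurd h1 (by norm_num)
          · intro ha
            rw [if_pos ha, Finset.card_singleton]
        rw [this, hPa]
    | succ n ih =>
      intro k hk
      have hkD : k ≤ D := by omega
      obtain ⟨ih2, ih1⟩ := ih (k + 1) (by omega)
      -- the split `insert a (Bge k) = Bk k ⊔ insert a (Bge (k+1))`
      have hU : Bk k ∪ insert a (Bge (k + 1)) = insert a (Bge k) := by
        ext y
        simp only [hBk, hBge, Finset.mem_union, Finset.mem_filter, Finset.mem_insert]
        constructor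
        · rintro (⟨hy, h⟩ | rfl | ⟨hy, h⟩)
          · exact Or.inr ⟨hy, by omega⟩
          · exact Or.inl rfl
          · exact Or.inr ⟨hy, by omega⟩
        · rintro (rfl | ⟨hy, h⟩)
          · exact Or.inr (Or.inl rfl)
          · by_cases hky : L y = k
            · exact Or.inl ⟨hy, hky⟩
            · exact Or.inr (Or.inr ⟨hy, by omega⟩)
      have hdj : Disjoint (Bk k) (insert a (Bge (k + 1))) := by
        rw [Finset.disjoint_insert_right]
        refine ⟨fun h => haB (Finset.mem_of_mem_filter a h), ?_⟩
        rw [Finset.disjoint_left]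
        intro y hy1 hy2
        rw [hBk, Finset.mem_filter] at hy1
        rw [hBge, Finset.mem_filter] at hy2
        omega
      have hA1 : ∀ b ∈ Bk k, anc⟦b⟧ = Ch⟦a, k⟧ ∪ inner b := by
        intro b hb
        rw [hBk, Finset.mem_filter] at hb
        rw [← hb.2]
        exact hsplit b hb.1
      have hA2 : ∀ y ∈ insert a (Bge (k + 1)), Ch⟦a, k⟧ ⊆ anc⟦y⟧ := by
        intro y hy
        rcases Finset.mem_insert.1 hy with rfl | hy
        · exact hChA k
        · rw [hBge, Finset.mem_filter] at hy
          exact hChY k y hy.1 (by omega)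
      have hKI' : ∀ b ∈ Bk k, Disjoint (Ch⟦a, k⟧) (inner b) := fun b hb => hKI k b (Finset.mem_of_mem_filter b hb)
      have hIA' : ∀ b ∈ Bk k, ∀ y ∈ insert a (Bge (k + 1)), Disjoint (inner b) (anc⟦y⟧) := by
        intro b hb y hy
        rw [hBk, Finset.mem_filter] at hb
        rcases Finset.mem_insert.1 hy with rfl | hy
        · exact Finset.sdiff_disjoint
        · rw [hBge, Finset.mem_filter] at hy
          exact inner_disjoint_anc_of_level_ne o depth par hstep hao (hBo b hb.1) (hBo y hy.1) (by
            show L b ≠ L y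
            omega)
      have step := chain_step_real q (fun y => anc⟦y⟧) inner (Ch⟦a, k⟧) (Bk k) (insert a (Bge (k + 1))) hdj hA1 hA2 hKI' hIA'
      simp only [hU] at step
      obtain ⟨st2, st1⟩ := step
      rw [List.range'_succ, List.map_cons, SecondWeight.EFG_cons]
      constructor
      · rw [st2, ih2, ih1]
        simp only [hlev]
        ring
      · rw [st1, ih1]
        simp only [hlev]
        ring
  -- Step 2: at `k = 0` the event is the target; the levels are admissible, sorted, with `σ = Σ_B T b ≥ 1`
  obtain ⟨h2, -⟩ := hrec (D + 1) 0 (by omega)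
  have hBge0 : Bge 0 = B := Finset.filter_true_of_mem fun b _ => Nat.zero_le _
  rw [hBge0] at h2
  rw [h2]
  -- admissibility of the levels
  have hLAdm : ∀ l ∈ (List.range' 0 (D + 1)).map lev,
      ((0 ≤ l.2.1 ∧ 0 ≤ l.2.2.1 ∧ 0 ≤ l.2.2.2.1 ∧ l.2.1 + l.2.2.1 + l.2.2.2.1 = 1 ∧ x ≤ l.1 ∧ l.1 ≤ 1) ∧ 0 ≤ l.2.2.2.2 ∧
        ((l.2.1 = 1 ∧ l.2.2.1 = 0 ∧ l.2.2.2.1 = 0 ∧ l.2.2.2.2 = 0) ∨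
          ∃ n : ℕ, 1 ≤ n ∧ l.2.2.1 ≤ l.2.2.2.2 ∧ l.2.2.2.2 ≤ l.2.2.1 + n * l.2.2.2.1 ∧ (n : ℝ) * x ≤ l.1 * l.2.2.2.2)) := by
    intro l hl
    obtain ⟨j, hj, rfl⟩ := List.mem_map.1 hl
    simp only [hlev]
    refine ⟨⟨measureReal_nonneg, measureReal_nonneg, measureReal_nonneg, count_trichotomy_real q (Bk j) inner, hxπ j,
      prod_unit_le_one q _⟩, Finset.sum_nonneg fun b _ => prod_unit_nonneg q _, ?_⟩
    by_cases hBkj : Bk j = ∅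
    · left
      have hc : ∀ ω : Set ι, ((Bk j).filter fun b => ((inner b : Finset ι) : Set ι) ⊆ ω).card = 0 := by
        intro ω; rw [hBkj, Finset.filter_empty, Finset.card_empty]
      refine ⟨?_, ?_, ?_, ?_⟩
      · show μ.real {ω : Set ι | ((Bk j).filter fun b => ((inner b : Finset ι) : Set ι) ⊆ ω).card = 0} = 1
        have : {ω : Set ι | ((Bk j).filter fun b => ((inner b : Finset ι) : Set ι) ⊆ ω).card = 0} = Set.univ :=
          Set.eq_univ_iff_forall.2 fun ω => hc ω
        rw [this, probReal_univ]
      · show μ.real {ω : Set ι | ((Bk j).filter fun b => ((inner b : Finset ι) : Set ι) ⊆ ω).card = 1} = 0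
        have : {ω : Set ι | ((Bk j).filter fun b => ((inner b : Finset ι) : Set ι) ⊆ ω).card = 1} = ∅ := by
          rw [Set.eq_empty_iff_forall_notMem]
          intro ω hω
          have h1 : ((Bk j).filter fun b => ((inner b : Finset ι) : Set ι) ⊆ ω).card = 1 := hω
          rw [hc ω] at h1
          exact absurd h1 (by norm_num)
        rw [this, measureReal_empty]
      · show μ.real {ω : Set ι | 2 ≤ ((Bk j).filter fun b => ((inner b : Finset ι) : Set ι) ⊆ ω).card} = 0
        have : {ω : Set ι | 2 ≤ ((Bk j).filter fun b => ((inner b : Finset ι) : Set ι) ⊆ ω).card} = ∅ := by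
          rw [Set.eq_empty_iff_forall_notMem]
          intro ω hω
          have h1 : 2 ≤ ((Bk j).filter fun b => ((inner b : Finset ι) : Set ι) ⊆ ω).card := hω
          rw [hc ω] at h1
          exact absurd h1 (by norm_num)
        rw [this, measureReal_empty]
      · show ∑ b ∈ Bk j, ∏ i ∈ inner b, (q i : ℝ) = 0
        rw [hBkj, Finset.sum_empty]
    · right
      refine ⟨(Bk j).card, Finset.card_pos.2 (Finset.nonempty_iff_ne_empty.2 hBkj), ?_, ?_, ?_⟩
      · exact (count_moment_bounds q (Bk j) inner).1
      · exact (count_moment_bounds q (Bk j) inner).2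
      · show ((Bk j).card : ℝ) * x ≤ π j * ∑ b ∈ Bk j, ∏ i ∈ inner b, (q i : ℝ)
        rw [Finset.mul_sum]
        have : ((Bk j).card : ℝ) * x = ∑ b ∈ Bk j, x := by rw [Finset.sum_const, nsmul_eq_mul]
        rw [this]
        refine Finset.sum_le_sum fun b hb => ?_
        rw [hBk, Finset.mem_filter] at hb
        rw [← hb.2, ← hTb b hb.1]
        exact hge b hb.1
  have hsort : (List.map (fun l : ℝ × ℝ × ℝ × ℝ × ℝ => l.1) ((List.range' 0 (D + 1)).map lev)).Pairwise (fun u v => v ≤ u) := by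
    rw [List.map_map]
    have : (fun l : ℝ × ℝ × ℝ × ℝ × ℝ => l.1) ∘ lev = π := by funext j; simp [hlev]
    rw [this]
    exact pairwise_map_range'_of_succ_le π hπanti 0 (D + 1)
  have hlev_ge := SecondWeight.secondWeight_levels hxpos ((List.range' 0 (D + 1)).map lev) hLAdm hsort
  -- `σ = Σ_B T b ≥ 1`
  have hσ : σG[(List.range' 0 (D + 1)).map lev] = ∑ b ∈ B, ∏ i ∈ anc⟦b⟧, (q i : ℝ) := by
    rw [List.map_map]
    have : (fun l : ℝ × ℝ × ℝ × ℝ × ℝ => l.1 * l.2.2.2.2) ∘ lev = fun j => π j * m j := by funext j; simp [hlev]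
    rw [this, sum_map_range']
    simp only [zero_add]
    rw [← Finset.sum_fiberwise_of_maps_to (s := B) (t := Finset.range (D + 1)) (g := L)
      (fun b hb => Finset.mem_range.2 (by have := (hLk b hb).2; omega))]
    refine Finset.sum_congr rfl fun j _ => ?_
    rw [hm]
    simp only
    rw [Finset.mul_sum]
    refine Finset.sum_congr rfl fun b hb => ?_
    rw [Finset.mem_filter] at hb
    rw [hTb b hb.1, hb.2]
  rw [hσ, min_eq_left hsum, mul_one] at hlev_ge
  exact hlev_ge

/-- **Counting form (layer one on every tree, gate coordinates).**  For a finite set `R` of non-root vertices and `a ∈ R` whose marginal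
`∏_{anc a} q` is minimal on `R`, with `1 ≤ Σ_{y ∈ R ∖ a} ∏_{anc y} q`:  `P(#{y ∈ R : anc y open} ≤ 1) ≤ 1 − ∏_{anc a} q`. [this work] -/
theorem tree_card_le_one_le_of_sum (hstep : ∀ x, x ≠ o → depth x ≠ 0 → par x ≠ o ∧ depth (par x) + 1 = depth x)
    [Finite ι] (q : ι → unitInterval) (R : Finset ι) (hoR : o ∉ R) {a : ι} (haR : a ∈ R)
    (hmin : ∀ y ∈ R, ∏ i ∈ anc⟦a⟧, (q i : ℝ) ≤ ∏ i ∈ anc⟦y⟧, (q i : ℝ))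
    (hsum : 1 ≤ ∑ y ∈ R.erase a, ∏ i ∈ anc⟦y⟧, (q i : ℝ)) :
    (prodBernoulli q).real {ω : Set ι | (R.filter fun y => ((anc⟦y⟧ : Finset ι) : Set ι) ⊆ ω).card ≤ 1} ≤
      1 - ∏ i ∈ anc⟦a⟧, (q i : ℝ) := by
  have hmeas : ∀ S : Set (Set ι), MeasurableSet S := fun S => (Set.toFinite S).measurableSet
  have hao : a ≠ o := fun h => hoR (h ▸ haR)
  have h := tree_twoReached_ge o depth par hstep q hao (R.erase a) (Finset.notMem_erase a R)
    (fun h => hoR (Finset.mem_of_mem_erase h)) (fun b hb => hmin b (Finset.mem_of_mem_erase hb)) hsum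
  rw [Finset.insert_erase haR] at h
  have hcompl : {ω : Set ι | (R.filter fun y => ((anc⟦y⟧ : Finset ι) : Set ι) ⊆ ω).card ≤ 1} =
      {ω : Set ι | 2 ≤ (R.filter fun y => ((anc⟦y⟧ : Finset ι) : Set ι) ⊆ ω).card}ᶜ := by
    ext ω; simp only [Set.mem_setOf_eq, Set.mem_compl_iff, not_le]; omega
  rw [hcompl, probReal_compl_eq_one_sub (hmeas _)]
  linarith

end Quant

end Summit.CriticalPhenomena.PercolationContinuityZ3.Theorems

end
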